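import Summits.CriticalPhenomena.Ising3D.Control2DL15TwoSidedNoWindow
import Summits.CriticalPhenomena.Ising3D.Control2DL15BoxS
import Mathlib.Tactic.NormNum
import HarnessLib

/-!
# The class-1 2D control in the kernel, lower edge `0.96`: `0.96 < Δ_ε < 1.0006` at `Δ_σ = 1/8` under `A2D′`, no window
(cell `pub-ising3x`, seat controls-1 gen 18; KERNEL PATH for the 2D γ-certificates, Λ ≤ 15 class-1 cover — CONTROL-ONLY)

HONEST FRAMING: lottery ticket; floor = tightest certified 3D Ising CFT bounds; no exact-solution
claim without a proof. CONTROL-ONLY (`d = 2`, `Δ_σ = 1/8`, axiom set `A2D′`); nothing about `d = 3`; weaker than the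
reader-certified statement of record (`0.99 < Δ_ε < 1.00005`, Λ = 19, readers A ∧ B).

The RB-3 Λ = 15 / E₀ = 40 box S `[19/20, 24/25]` (`j117772`), the first certificate landed in the FLAT cell-data layout
(`Control2DCellGroups`: independent index-group sums, `Control2DL15BoxS`), appended to the no-window cover:
* `excludedOn_2d_cover096 : ExcludedOn (1/8) 2 1 (Icc 0 (24/25))`;
* `twoSided_2d_kernel096 (w) : TwoSided (1/8) 2 1 w (24/25) (5003/5000)` for EVERY real `w`.
(`Control2DL15TwoSided097` continues with box T and the Λ = 15 gap certificate.) No facts, standard axioms only.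
-/

namespace Summit.CriticalPhenomena.Ising3D.Control2D

open Set
open Literature.MathematicalPhysics.QuantumFieldTheory.ConformalBootstrap3D

/-- **Kernel-complete cover of the `ε` locations `[0, 24/25]`** at `Δ_σ = 1/8` under `A2D′` (box S appended).
CONTROL-ONLY (d = 2). [cite: RattazziEtAl2008, §5.5] -/
theorem excludedOn_2d_cover096 : ExcludedOn (1 / 8 : ℝ) 2 1 (Icc (0 : ℝ) (24 / 25)) :=
  excludedOn_Icc_append excludedOn_2d_cover_noWindow excludedOn_2d_L15_boxS le_rfl

/-- **2D control, class 1, kernel-complete, lower edge from a Λ = 15 certificate, for EVERY window parameter `w`**: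
under `A2D′` at `Δ_σ = 1/8` the `ε` location satisfies `24/25 < Δ_ε < 5003/5000`. CONTROL-ONLY (d = 2).
[cite: RattazziEtAl2008, §5.5] -/
theorem twoSided_2d_kernel096 (w : ℝ) : TwoSided (1 / 8 : ℝ) 2 1 w (24 / 25) (5003 / 5000) :=
  twoSided_of_cover_zero excludedOn_2d_cover096 gapExcluded_2d_L11_gapA (by norm_num) w

end Summit.CriticalPhenomena.Ising3D.Control2D
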